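import Mathlib
import Summits.ValiantsHypothesis.ValiantsHypothesis.Theorems.DivisionGapDefs
import Summits.ValiantsHypothesis.ValiantsHypothesis.Theorems.DivisionGapPerDivisionHardStubSparseRigidCount

/-!
# `DivisionGap.PerCofactorDegreeReduction` (stmt-ValiantsHypothesis-15046), line `Sketch_ideator4`:
dominant hole isolation (stub `stub_dominantHoleIsolation`, K)

Isolation step for the host `G = supp u ∪ (Vr × Vc)` of the isolated-strip theorem, when the
multiplier `h` (over `ℝ≥0`) is TORUS-HOMOGENEOUS (all monomials of `h` have the same row-sum
vector `Finsupp.mapDomain Prod.fst m` and the same column-sum vector `Finsupp.mapDomain Prod.snd m`),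
the monomial `u` of `h` is DOMINANT (`∀ v ∈ supp h, ∀ e ∈ supp u, v e ≤ u e`) and `u` VANISHES on
the block `Vr × Vc` (no cell of `supp u` has its row in `Vr` and its column in `Vc`).  Then `u` is
the only monomial `v` of `h` with `supp v ⊆ supp u ∪ Vr ×ˢ Vc` (margin double count):

* off the block, `v ≤ u` pointwise (dominance on `supp u`, and `v = 0` elsewhere);
* a row `i ∉ Vr` is entirely off-block, so `v (i,·) ≤ u (i,·)` termwise with equal row sums,
  hence `v (i,·) = u (i,·)` (`Finset.sum_eq_sum_iff_of_le`); likewise a column `j ∉ Vc`;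
* in a row `i ∈ Vr` we get `u (i,·) ≤ v (i,·)` termwise (`u (i,j) = 0` for `j ∈ Vc`, equality
  for `j ∉ Vc` by the column step), again with equal row sums, hence `u (i,·) = v (i,·)`.

Row and column sums are the margins `rowDegrees_apply`, `colDegrees_apply` of
`DivisionGapPerDivisionHardStubSparseRigidCount`.  No definitions in this file. [folklore]
-/

noncomputable section

-- `Summit.ValiantsHypothesis.ValiantsHypothesis.…` is the tree's mandated single-conjunct layout
-- (Sub = Summit), so the duplicated namespace component is intended.
set_option linter.dupNamespace false

open MvPolynomial Literature.Computability.AlgebraicComplexity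
open Summit.ValiantsHypothesis.ValiantsHypothesis.Theorems.DivisionGapPerDivisionHard
  (rowDegrees_apply colDegrees_apply)
open scoped NNReal

namespace Summit.ValiantsHypothesis.ValiantsHypothesis.Theorems.DivisionGap.PerCofactorDegreeReduction.DominantHoleIsolation

variable {n : ℕ}

/-! ### The margin double count -/

/-- Two rows (or columns) that are termwise comparable and have the same sum agree termwise.
[folklore] -/
theorem eq_of_le_of_sum_eq {f g : Fin n → ℕ} (hle : ∀ j, f j ≤ g j)
    (hsum : ∑ j, f j = ∑ j, g j) (j : Fin n) : f j = g j :=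
  (Finset.sum_eq_sum_iff_of_le fun j _ => hle j).1 hsum j (Finset.mem_univ j)

/-- **Dominant hole isolation (stub `stub_dominantHoleIsolation`, K, of line `Sketch_ideator4`).**
If `h` is torus-homogeneous (all monomials share their row-sum and column-sum vectors), `u ∈ supp h`
dominates every monomial of `h` on `supp u`, and `supp u` avoids the block `Vr × Vc`, then `u` is
the only monomial of `h` supported inside `supp u ∪ Vr ×ˢ Vc` (margin double count, see the
module docstring). [folklore] -/
theorem stub_dominantHoleIsolation :
    ∀ (n : ℕ) (h : MvPolynomial (Fin n × Fin n) ℝ≥0) (u : (Fin n × Fin n) →₀ ℕ)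
      (Vr Vc : Finset (Fin n)),
      u ∈ h.support →
      (∃ τ : (Fin n →₀ ℕ) × (Fin n →₀ ℕ),
        ∀ m ∈ h.support, (Finsupp.mapDomain Prod.fst m, Finsupp.mapDomain Prod.snd m) = τ) →
      (∀ v ∈ h.support, ∀ e ∈ u.support, v e ≤ u e) →
      (∀ e ∈ u.support, e.1 ∈ Vr → e.2 ∉ Vc) →
      ∀ v ∈ h.support, v.support ⊆ u.support ∪ Vr ×ˢ Vc → v = u := by
  intro n h u Vr Vc hu hτ hdom hblock v hv hsub
  obtain ⟨τ, hτ⟩ := hτ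
  -- equal margins of `v` and `u`
  have hmarg : (Finsupp.mapDomain Prod.fst v, Finsupp.mapDomain Prod.snd v) =
      (Finsupp.mapDomain Prod.fst u, Finsupp.mapDomain Prod.snd u) :=
    (hτ v hv).trans (hτ u hu).symm
  obtain ⟨hrow, hcol⟩ := Prod.mk.inj hmarg
  -- row sums (`rowDegrees m = Finsupp.mapDomain Prod.fst m` by definition) and column sums
  have hrowSum : ∀ i, ∑ j, v (i, j) = ∑ j, u (i, j) := fun i => by
    rw [← rowDegrees_apply, ← rowDegrees_apply]
    exact DFunLike.congr_fun hrow i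
  have hcolSum : ∀ j, ∑ i, v (i, j) = ∑ i, u (i, j) := fun j => by
    rw [← colDegrees_apply, ← colDegrees_apply, hcol]
  -- (a) off the block, `v ≤ u` pointwise
  have hle : ∀ e : Fin n × Fin n, ¬(e.1 ∈ Vr ∧ e.2 ∈ Vc) → v e ≤ u e := by
    intro e he
    by_cases hev : e ∈ v.support
    · rcases Finset.mem_union.1 (hsub hev) with heu | heb
      · exact hdom v hv e heu
      · exact absurd (Finset.mem_product.1 heb) he
    · rw [Finsupp.notMem_support_iff.1 hev]
      exact Nat.zero_le _
  -- (b) rows off `Vr` agree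
  have hrowEq : ∀ i, i ∉ Vr → ∀ j, v (i, j) = u (i, j) := fun i hi =>
    eq_of_le_of_sum_eq (fun j => hle (i, j) fun hb => hi hb.1) (hrowSum i)
  -- (c) columns off `Vc` agree
  have hcolEq : ∀ j, j ∉ Vc → ∀ i, v (i, j) = u (i, j) := fun j hj =>
    eq_of_le_of_sum_eq (f := fun i => v (i, j)) (g := fun i => u (i, j))
      (fun i => hle (i, j) fun hb => hj hb.2) (hcolSum j)
  -- (d) rows in `Vr`: `u ≤ v` termwise with equal sums
  have hholeEq : ∀ i, i ∈ Vr → ∀ j, u (i, j) = v (i, j) := fun i hi =>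
    eq_of_le_of_sum_eq (fun j => by
      by_cases hj : j ∈ Vc
      · have hu0 : u (i, j) = 0 :=
          Finsupp.notMem_support_iff.1 fun hmem => hblock (i, j) hmem hi hj
        rw [hu0]
        exact Nat.zero_le _
      · exact (hcolEq j hj i).ge) (hrowSum i).symm
  -- conclusion
  ext ⟨i, j⟩
  by_cases hi : i ∈ Vr
  · exact (hholeEq i hi j).symm
  · exact hrowEq i hi j

end Summit.ValiantsHypothesis.ValiantsHypothesis.Theorems.DivisionGap.PerCofactorDegreeReduction.DominantHoleIsolation

end
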